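import Mathlib
import HarnessLib

/-!
# Blokhuis' bound `2^m` for Sperner families of the cyclic triangle

Topic `Literature/Combinatorics/Extremal`.  A family `R ⊆ (ℤ/3)^m` is a *Sperner family of the cyclic
triangle* (Gargano–Körner–Vaccaro; Calderbank–Frankl–Graham–Li–Shepp, J. Algebraic Combin. 2 (1993)
31–48) if for any two distinct `r, r' ∈ R` there is a coordinate `i` with `r' i - r i = 1` — an edge of
the cyclically oriented triangle `0 → 1 → 2 → 0` from `r i` to `r' i`.  A. Blokhuis, *On the Sperner
capacity of the cyclic triangle*, J. Algebraic Combin. 2 (1993) 123–124, proved `|R| ≤ 2^m` by the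
polynomial method: the functions `P_r(x) = ∏_i (x_i - r_i - 1)` vanish at every other member of the
family and not at `r`, so they are linearly independent, and they lie in the `2^m`-dimensional span of
the multilinear monomials `∏_{i ∈ S} x_i`.  Together with the antichain lower bound `binom(m, ⌊m/2⌋)`
this shows that the Sperner capacity of the cyclic triangle is `log 2`.

* `card_le_two_pow_of_cyclicTriangle_sperner` — Blokhuis' theorem, fully proved;
* `exists_cyclicTriangle_sperner_card_choose` — the antichain code of size `binom(m,k)` (lower bound).

(Used in `Summits/MatrixMultiplication/…` as the ceiling `β ≤ log 2 / log 3` of base-`3` digit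
constructions of square-difference-free sets in number rings in which `3` splits completely; see the
evidence note `NumberRingLift.md` on item stmt-MatrixMultiplication-14080.)  No definitions.

## References
* A. Blokhuis, J. Algebraic Combin. 2 (1993) 123–124, Theorem. [Blokhuis1993SpernerCapacityCyclicTriangle]
-/

namespace Literature.Combinatorics.Extremal

open Finset

/-- **Blokhuis (1993).**  If `R ⊆ (ℤ/3)^m` and any two distinct members `r ≠ r'` of `R` have a
coordinate `i` with `r' i - r i = 1`, then `|R| ≤ 2^m`.
[cite: Blokhuis1993SpernerCapacityCyclicTriangle, Theorem] -/
theorem card_le_two_pow_of_cyclicTriangle_sperner {m : ℕ} (R : Finset (Fin m → ZMod 3))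
    (hR : ∀ r ∈ R, ∀ r' ∈ R, r ≠ r' → ∃ i, r' i - r i = 1) : R.card ≤ 2 ^ m := by
  classical
  -- Blokhuis' polynomials and the multilinear monomials, as functions on `(ℤ/3)^m`
  let P : (Fin m → ZMod 3) → (Fin m → ZMod 3) → ZMod 3 := fun r x => ∏ i, (x i - r i - 1)
  let M : Finset (Fin m) → (Fin m → ZMod 3) → ZMod 3 := fun S x => ∏ i ∈ S, x i
  let W : Submodule (ZMod 3) ((Fin m → ZMod 3) → ZMod 3) := Submodule.span (ZMod 3) (Set.range M)
  -- (1) every `P r` lies in the span `W` of the `2^m` monomials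
  have hPW : ∀ r, P r ∈ W := by
    intro r
    have hexp : P r = ∑ S ∈ (univ : Finset (Fin m)).powerset,
        (∏ i ∈ univ \ S, (-(r i) - 1)) • M S := by
      funext x
      rw [Finset.sum_apply]
      simp only [P, M, Pi.smul_apply, smul_eq_mul]
      have : ∀ i, x i - r i - 1 = x i + (-(r i) - 1) := fun i => by ring
      simp_rw [this]
      rw [Finset.prod_add]
      refine Finset.sum_congr rfl fun S _ => ?_
      ring
    rw [hexp]
    refine Submodule.sum_mem _ fun S _ => Submodule.smul_mem _ _ ?_
    exact Submodule.subset_span ⟨S, rfl⟩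
  -- (2) evaluations: `P r r' = 0` for distinct members, `P r r = (-1)^m ≠ 0`
  have hzero : ∀ r ∈ R, ∀ r' ∈ R, r ≠ r' → P r r' = 0 := by
    intro r hr r' hr' hne
    obtain ⟨i, hi⟩ := hR r hr r' hr' hne
    simp only [P]
    exact Finset.prod_eq_zero (Finset.mem_univ i) (by rw [hi]; ring)
  have hdiag : ∀ r, P r r ≠ 0 := by
    intro r
    simp only [P, sub_self, zero_sub, Finset.prod_const, Finset.card_univ, Fintype.card_fin]
    exact pow_ne_zero _ (by decide)
  -- (3) the family `(P r)_{r ∈ R}` is linearly independent, already inside `W`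
  have hli : LinearIndependent (ZMod 3) (fun r : R => (⟨P r, hPW r⟩ : W)) := by
    apply LinearIndependent.of_comp W.subtype
    rw [linearIndependent_iff']
    intro s g hg i hi
    have h := congrFun hg (i : Fin m → ZMod 3)
    rw [Finset.sum_apply] at h
    simp only [Function.comp_apply, Submodule.subtype_apply, Pi.smul_apply, smul_eq_mul,
      Pi.zero_apply] at h
    rw [Finset.sum_eq_single i] at h
    · exact (mul_eq_zero.mp h).resolve_right (hdiag _)
    · intro j _ hji
      have hne : (j : Fin m → ZMod 3) ≠ i := fun e => hji (Subtype.ext e)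
      rw [hzero _ j.2 _ i.2 hne, mul_zero]
    · intro hi'
      exact absurd hi hi'
  -- (4) count dimensions
  have h1 : Fintype.card R ≤ Module.finrank (ZMod 3) W := hli.fintype_card_le_finrank
  have h2 : Module.finrank (ZMod 3) W ≤ Fintype.card (Finset (Fin m)) := finrank_range_le_card M
  rw [Fintype.card_coe] at h1
  rw [Fintype.card_finset, Fintype.card_fin] at h2
  exact h1.trans h2

/-- **The matching lower bound (Calderbank–Frankl–Graham–Li–Shepp 1993; folklore antichain code).**  For
every `k ≤ m` the indicator vectors of the `k`-subsets of `Fin m` form a Sperner family of the cyclic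
triangle in `(ℤ/3)^m` of size `binom(m, k)`: two distinct `k`-sets `S ≠ S'` have an element
`i ∈ S' ∖ S`, where the indicators differ by `1 - 0 = 1`.  With `k = ⌊m/2⌋` and Blokhuis' bound this
pins the Sperner capacity of the cyclic triangle at `log 2`. [folklore] -/
theorem exists_cyclicTriangle_sperner_card_choose (m k : ℕ) :
    ∃ R : Finset (Fin m → ZMod 3), R.card = m.choose k ∧
      ∀ r ∈ R, ∀ r' ∈ R, r ≠ r' → ∃ i, r' i - r i = 1 := by
  classical
  let ind : Finset (Fin m) → (Fin m → ZMod 3) := fun S i => if i ∈ S then 1 else 0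
  have hinj : Function.Injective ind := by
    intro S S' h
    ext i
    have := congrFun h i
    simp only [ind] at this
    by_cases hi : i ∈ S <;> by_cases hi' : i ∈ S' <;> simp_all
  refine ⟨((univ : Finset (Fin m)).powersetCard k).image ind, ?_, ?_⟩
  · rw [card_image_of_injective _ hinj, card_powersetCard, card_univ, Fintype.card_fin]
  · intro r hr r' hr' hne
    simp only [mem_image, mem_powersetCard] at hr hr'
    obtain ⟨S, ⟨-, hS⟩, rfl⟩ := hr
    obtain ⟨S', ⟨-, hS'⟩, rfl⟩ := hr'
    -- `S' ⊄ S` since the two sets are distinct of the same size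
    have hnot : ¬ S' ⊆ S := by
      intro hsub
      have : S' = S := Finset.eq_of_subset_of_card_le hsub (by rw [hS, hS'])
      exact hne (by rw [this])
    obtain ⟨i, hiS', hiS⟩ := Finset.not_subset.mp hnot
    exact ⟨i, by simp [ind, hiS', hiS]⟩

end Literature.Combinatorics.Extremal
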